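import Summits.CriticalPhenomena.Ising3DConformalLimit.Theorems.EnergyNotSigmaSquaredMoebiusLimitExistsPedigreeStepAux
import Summits.CriticalPhenomena.Ising3DConformalLimit.Theorems.EnergyNotSigmaSquaredMoebiusLimitExistsSVEquicontTransport
import Summits.CriticalPhenomena.Ising3DConformalLimit.Theorems.EnergyNotSigmaSquaredMoebiusLimitExistsClusterPointInequalities
import Literature.MathematicalPhysics.QuantumFieldTheory.PointwiseOSReconstruction
import HarnessLib

/-!
# Cluster points of the pinned critical zoom inherit OSTERWALDER–SCHRADER POSITIVITY along every axis
(line `only-interaction-breaks-moebius`, crux `MoebiusLimitExists`, item stmt-CriticalPhenomena-1344, route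
`EnergyNotSigmaSquared`; inherited constraints of the objects of the crux-sized residue 5′)

A cluster point `S` of the pinned zoom (`IsClusterPoint`: locally uniform limit, off the diagonals, of
`ρ_pin(u_k)ⁿ ⟨σ_{[x₁/u_k]} ⋯ σ_{[xₙ/u_k]}⟩_{β_c}` along one mesh sequence for all `n`) inherits from the critical
`ℤ³` state, by passage to the limit:
* `IsClusterPoint.isPermutationSymmetric_os` — (E3) permutation symmetry (exact on the lattice);
* `IsClusterPoint.isReflectionInvariantAlong_os` — invariance under the coordinate reflections `θ_τ` (lattice
  hyperoctahedral invariance `criticalCorr_latticeMirror_zero_cm`; the lattice reflection of `[θ_τ x/δ]` is the lattice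
  approximation of a configuration within `O(δ)` of `x`, absorbed by continuity of `S` off the diagonals);
* `IsClusterPoint.isReflectionPositiveAlong_os` — REFLECTION POSITIVITY along every coordinate axis `τ` in the
  pointwise sense of `Literature.MathematicalPhysics.QuantumFieldTheory.IsReflectionPositiveAlong` (Glimm–Jaffe OS3 for
  point configurations): site-mirror reflection positivity of the critical state in the plane `{v_τ = 0}`
  (`rp_latticeMirror_zero_cm`, FILS 1978) applied to the lattice approximations of the half-space configurations with
  coefficients `c_a ρ_pin(δ)^{n_a}`, then the limit along the lifts `δ(Θ[a/δ] ++ [b/δ]) → (θ_τ a ++ b)`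
  (`norm_lift_latticeMirror_sub_reflectZ_le_ps`, `reflectZ (e_τ) 0 = θ_τ`).
* `IsClusterPoint.hasPolynomialTimeGrowth_os` (no growth at all, from `clusterPoint_le_pairingSum` and the pure-power
  pair function) and `IsClusterPoint.pointwiseOSReconstruction_os`: a REGULAR cluster point with `S₂ = ‖x−y‖^{-2Δ}`,
  `Δ ≥ 0` (forced by item 0634's two-point law, `delta_nonneg_of_twoPointLaw_os`), satisfies ALL premises of the tree's
  `PointwiseOSReconstruction` along every axis — the positivity input any engine for the residue 5′ must start from
  (Disproof §F.5). No definitions.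
-/

noncomputable section

open Filter Topology Set Function Metric
open Literature.Probability.LatticeModels
open Literature.MathematicalPhysics.QuantumFieldTheory

namespace Summit.CriticalPhenomena.Ising3DConformalLimit.MoebiusLimitExistsOnlyInteraction

/-! ### The coordinate direction `e_τ` as a cubic direction -/

/-- `e_τ` is a cubic direction. [folklore] -/
theorem isCubicDir_single_os (τ : Fin 3) : IsCubicDir (Pi.single τ (1 : ℤ)) := by
  refine ⟨fun j => ?_, Or.inl ?_⟩
  · by_cases h : j = τ
    · subst h; simp
    · simp [h]
  · fin_cases τ <;> simp [zdot]

/-- `g·[p/δ] = [p_τ/δ]` for `g = e_τ`. [folklore] -/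
theorem zdot_single_left_os (τ : Fin 3) (v : Site 3) : zdot (Pi.single τ (1 : ℤ)) v = v τ := by
  fin_cases τ <;> simp [zdot]

/-- The Euclidean mirror of `e_τ` through the origin is the axis reflection `θ_τ`. [folklore] -/
theorem reflectZ_single_zero_os (τ : Fin 3) (q : EuclideanSpace ℝ (Fin 3)) :
    reflectZ (Pi.single τ (1 : ℤ)) 0 q = axisReflection τ q := by
  ext i
  rw [reflectZ_apply, axisReflection_apply]
  fin_cases τ <;> fin_cases i <;> simp [rdotZ, zdot] <;> ring

/-- `‖δ Θ₀[(θ_τ p)/δ] − p‖ ≤ 22δ` (`Θ₀ = latticeMirror e_τ 0`). [folklore] -/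
theorem norm_lift_latticeMirror_axisReflection_sub_le_os (τ : Fin 3) {δ : ℝ} (hδ : 0 < δ)
    (p : EuclideanSpace ℝ (Fin 3)) :
    ‖(δ • siteVec (latticeMirror (Pi.single τ (1 : ℤ)) 0 (latticeApprox δ (axisReflection τ p))) :
        EuclideanSpace ℝ (Fin 3)) - p‖ ≤ 22 * δ := by
  have h := norm_lift_latticeMirror_sub_reflectZ_le_ps (isCubicDir_single_os τ) hδ 0 (axisReflection τ p)
  rwa [zero_div, Int.floor_zero, reflectZ_single_zero_os, axisReflection_axisReflection] at h

/-- `‖δ Θ₀[q/δ] − θ_τ q‖ ≤ 22δ`. [folklore] -/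
theorem norm_lift_latticeMirror_sub_axisReflection_le_os (τ : Fin 3) {δ : ℝ} (hδ : 0 < δ)
    (q : EuclideanSpace ℝ (Fin 3)) :
    ‖(δ • siteVec (latticeMirror (Pi.single τ (1 : ℤ)) 0 (latticeApprox δ q)) : EuclideanSpace ℝ (Fin 3)) -
        axisReflection τ q‖ ≤ 22 * δ := by
  have h := norm_lift_latticeMirror_sub_reflectZ_le_ps (isCubicDir_single_os τ) hδ 0 q
  rwa [zero_div, Int.floor_zero, reflectZ_single_zero_os] at h

/-! ### Permutation symmetry -/

/-- **(E3) Cluster points are permutation symmetric** (normalised ones, everywhere): the pinned zoom is exactly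
symmetric at every mesh (`rescaledCorrelator_comp_perm_tr`); off `NonCoincident` both sides vanish. [folklore] -/
theorem IsClusterPoint.isPermutationSymmetric_os {S : CorrFamily 3} (hS : IsClusterPoint S) (hN : IsNormalised S) :
    IsPermutationSymmetric S := by
  intro n σ x
  by_cases hx : x ∈ NonCoincident 3 n
  · obtain ⟨u, -, hconv⟩ := hS
    have hxσ : x ∘ ⇑σ ∈ NonCoincident 3 n := by
      rw [mem_nonCoincident] at hx ⊢
      exact hx.comp σ.injective
    have h1 := (hconv n).tendsto_at hxσ
    have h2 := (hconv n).tendsto_at hx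
    simp only [rescaledCorrelator_comp_perm_tr] at h1
    exact tendsto_nhds_unique h1 h2
  · have hxσ : x ∘ ⇑σ ∉ NonCoincident 3 n := fun h => hx (by
      rw [mem_nonCoincident] at h ⊢
      exact (σ.injective_comp x).1 h)
    rw [hN _ _ hxσ, hN _ _ hx]

/-! ### Reflection invariance along the axes -/

/-- **Cluster points are invariant under the coordinate reflections `θ_τ`** (normalised, continuous off the diagonals):
`⟨∏σ_{Θ₀ y}⟩ = ⟨∏σ_y⟩` on the lattice, and `Θ₀[θ_τ x/δ]` lifts to within `22δ` of `x`, so the zoom at `θ_τ x` is the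
zoom at configurations tending to `x` inside `NonCoincident`, where `S n` is continuous. [folklore] -/
theorem IsClusterPoint.isReflectionInvariantAlong_os {S : CorrFamily 3} (hS : IsClusterPoint S)
    (hN : IsNormalised S) (hcont : ∀ n, ContinuousOn (S n) (NonCoincident 3 n)) (τ : Fin 3) :
    IsReflectionInvariantAlong τ S := by
  intro n x
  have hθinj : Function.Injective (axisReflection (d := 3) τ) := (axisReflection τ).injective
  by_cases hx : x ∈ NonCoincident 3 n
  · obtain ⟨u, hu, hconv⟩ := hS
    have hupos : ∀ᶠ k in atTop, 0 < u k := (tendsto_nhdsWithin_iff.1 hu).2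
    have hu0 : Tendsto u atTop (𝓝 0) := (tendsto_nhdsWithin_iff.1 hu).1
    have hθx : (fun i => axisReflection τ (x i)) ∈ NonCoincident 3 n := by
      rw [mem_nonCoincident] at hx ⊢
      exact hθinj.comp hx
    set g : Site 3 := Pi.single τ (1 : ℤ) with hg'
    have hg : IsCubicDir g := isCubicDir_single_os τ
    set L : ℕ → Fin n → EuclideanSpace ℝ (Fin 3) := fun k i =>
      u k • siteVec (latticeMirror g 0 (latticeApprox (u k) (axisReflection τ (x i)))) with hL
    have hLx : Tendsto L atTop (𝓝 x) := by
      refine tendsto_pi_nhds.2 fun i => ?_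
      rw [tendsto_iff_norm_sub_tendsto_zero]
      refine squeeze_zero' (Eventually.of_forall fun k => norm_nonneg _) ?_
        (by simpa using hu0.const_mul (22 : ℝ))
      filter_upwards [hupos] with k hk
      exact norm_lift_latticeMirror_axisReflection_sub_le_os τ hk (x i)
    have hLmem : ∀ᶠ k in atTop, L k ∈ NonCoincident 3 n :=
      hLx.eventually_mem ((isOpen_nonCoincident 3 n).mem_nhds hx)
    have hLwithin : Tendsto L atTop (𝓝[NonCoincident 3 n] x) :=
      tendsto_nhdsWithin_iff.2 ⟨hLx, hLmem⟩
    have h1 : Tendsto (fun k => rescaledCorrelator (criticalCorr 3) rhoPin n (u k) (L k)) atTop (𝓝 (S n x)) :=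
      (hconv n).tendsto_comp ((hcont n).continuousWithinAt hx) hx hLwithin
    have h2 := (hconv n).tendsto_at hθx
    have heq : ∀ᶠ k in atTop, rescaledCorrelator (criticalCorr 3) rhoPin n (u k) (L k) =
        rescaledCorrelator (criticalCorr 3) rhoPin n (u k) (fun i => axisReflection τ (x i)) := by
      filter_upwards [hupos] with k hk
      rw [hL]
      simp only []
      rw [rescaledCorrelator_lift_ps hk, rescaledCorrelator_apply,
        show (fun i => latticeMirror g 0 (latticeApprox (u k) (axisReflection τ (x i)))) =
          latticeMirror g 0 ∘ fun i => latticeApprox (u k) (axisReflection τ (x i)) from rfl,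
        criticalCorr_latticeMirror_zero_cm hg]
    exact tendsto_nhds_unique (h2.congr' (heq.mono fun k hk => hk.symm)) h1
  · have hθx : (fun i => axisReflection τ (x i)) ∉ NonCoincident 3 n := fun h => hx (by
      rw [mem_nonCoincident] at h ⊢
      exact Function.Injective.of_comp h)
    rw [hN _ _ hθx, hN _ _ hx]

/-! ### Reflection positivity along the axes -/

/-- **OS POSITIVITY OF CLUSTER POINTS (Glimm–Jaffe OS3, pointwise form).** A cluster point of the pinned critical zoom,
continuous off the diagonals, is reflection positive along every coordinate axis: for half-space configurations
`a₁, …, a_k` (non-coincident points of `{x_τ > 0}`) and real `c₁, …, c_k`, `∑ᵢⱼ cᵢ cⱼ S(θ_τ aᵢ, aⱼ) ≥ 0`. Proof: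
site-mirror reflection positivity of the critical `ℤ³` state in the plane `{v_τ = 0}` (FILS) for the lattice
approximations `[aᵢ/δ]` (all in `{v_τ ≥ 0}`) with coefficients `cᵢ ρ_pin(δ)^{nᵢ}` gives
`∑ᵢⱼ cᵢ cⱼ F_δ^{(nᵢ+nⱼ)}(δ(Θ₀[aᵢ/δ] ++ [aⱼ/δ])) ≥ 0`, and each lift tends to `(θ_τ aᵢ ++ aⱼ)` inside `NonCoincident`,
where the zoom converges to the continuous `S`. [cite: FILS1978, §2] [cite: GlimmJaffe1987, §6.1 (OS3) eqs. (6.1.8)–(6.1.9)] -/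
theorem IsClusterPoint.isReflectionPositiveAlong_os {S : CorrFamily 3} (hS : IsClusterPoint S)
    (hcont : ∀ n, ContinuousOn (S n) (NonCoincident 3 n)) (τ : Fin 3) :
    IsReflectionPositiveAlong τ S := by
  intro k a c
  obtain ⟨u, hu, hconv⟩ := hS
  have hupos : ∀ᶠ m in atTop, 0 < u m := (tendsto_nhdsWithin_iff.1 hu).2
  have hu0 : Tendsto u atTop (𝓝 0) := (tendsto_nhdsWithin_iff.1 hu).1
  set g : Site 3 := Pi.single τ (1 : ℤ) with hg'
  have hg : IsCubicDir g := isCubicDir_single_os τ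
  set y : ℕ → (i : Fin k) → Fin (a i).n → Site 3 := fun m i l => latticeApprox (u m) ((a i).pts l) with hy
  set L : ℕ → (i j : Fin k) → Fin ((a i).n + (a j).n) → EuclideanSpace ℝ (Fin 3) := fun m i j l =>
    u m • siteVec (Fin.append (latticeMirror g 0 ∘ y m i) (y m j) l) with hL
  set w : (i j : Fin k) → Fin ((a i).n + (a j).n) → EuclideanSpace ℝ (Fin 3) := fun i j =>
    Fin.append (fun l => axisReflection τ ((a i).pts l)) (a j).pts with hw
  have hwmem : ∀ i j, w i j ∈ NonCoincident 3 ((a i).n + (a j).n) := fun i j =>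
    (mem_nonCoincident _).2 (osPointKernel_arg_injective (a i) (a j))
  have hLw : ∀ i j, Tendsto (fun m => L m i j) atTop (𝓝[NonCoincident 3 ((a i).n + (a j).n)] (w i j)) := by
    intro i j
    have hconv' : Tendsto (fun m => L m i j) atTop (𝓝 (w i j)) := by
      refine tendsto_pi_nhds.2 fun l => ?_
      rw [tendsto_iff_norm_sub_tendsto_zero]
      refine squeeze_zero' (Eventually.of_forall fun m => norm_nonneg _) ?_
        (by simpa using hu0.const_mul (22 : ℝ))
      filter_upwards [hupos] with m hm
      rw [hL, hw]
      refine Fin.addCases (fun l => ?_) (fun l => ?_) l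
      · simp only [Fin.append_left, Function.comp_apply]
        exact norm_lift_latticeMirror_sub_axisReflection_le_os τ hm _
      · simp only [Fin.append_right]
        linarith [norm_lift_latticeApprox_sub_le_ps hm ((a j).pts l)]
    exact tendsto_nhdsWithin_iff.2
      ⟨hconv', hconv'.eventually_mem ((isOpen_nonCoincident 3 _).mem_nhds (hwmem i j))⟩
  have hlim : ∀ i j, Tendsto (fun m => rescaledCorrelator (criticalCorr 3) rhoPin ((a i).n + (a j).n) (u m) (L m i j))
      atTop (𝓝 (osPointKernel S (a i) (a j))) := fun i j =>
    (hconv _).tendsto_comp ((hcont _).continuousWithinAt (hwmem i j)) (hwmem i j) (hLw i j)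
  have hpos : ∀ᶠ m in atTop, 0 ≤ ∑ i, ∑ j, c i * c j *
      rescaledCorrelator (criticalCorr 3) rhoPin ((a i).n + (a j).n) (u m) (L m i j) := by
    filter_upwards [hupos] with m hm
    have hz : ∀ i l, 0 ≤ zdot g (y m i l) := fun i l => by
      show 0 ≤ zdot (Pi.single τ (1 : ℤ)) (latticeApprox (u m) ((a i).pts l))
      rw [zdot_single_left_os, latticeApprox_apply]
      exact Int.floor_nonneg.2 (div_nonneg ((a i).pos l).le hm.le)
    have h := rp_latticeMirror_zero_cm hg k (fun i => (a i).n) (y m) (fun i => c i * rhoPin (u m) ^ (a i).n) hz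
    refine h.trans_eq (Finset.sum_congr rfl fun i _ => Finset.sum_congr rfl fun j _ => ?_)
    rw [hL]
    simp only []
    rw [rescaledCorrelator_lift_ps hm, pow_add]
    ring
  exact ge_of_tendsto (tendsto_finsetSum _ fun i _ => tendsto_finsetSum _ fun j _ => (hlim i j).const_mul _)
    hpos

/-! ### Polynomial (indeed no) growth in the time direction, and the OS reconstruction -/

/-- Transport of `S` across an index equality. [folklore] -/
theorem corr_cast_os (S : CorrFamily 3) {N N' : ℕ} (h : N = N') (x : Fin N → EuclideanSpace ℝ (Fin 3)) :
    S N x = S N' (fun i => x (Fin.cast h.symm i)) := by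
  subst h; rfl

/-- Odd orders of a cluster point vanish off the diagonals (`m*(β_c) = 0` on `ℤ³`).
[cite: AizenmanDuminilCopinSidoraviciusCMP2015, Thm. 1.2] -/
theorem clusterPoint_eq_zero_of_odd_os {S : CorrFamily 3} (hS : IsClusterPoint S) {n : ℕ} (hn : Odd n)
    {x : Fin n → EuclideanSpace ℝ (Fin 3)} (hx : x ∈ NonCoincident 3 n) : S n x = 0 := by
  obtain ⟨u, -, hconv⟩ := hS
  have h := (hconv n).tendsto_at hx
  have h0 : Tendsto (fun k => rescaledCorrelator (criticalCorr 3) rhoPin n (u k) x) atTop (𝓝 0) := by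
    refine tendsto_const_nhds.congr fun k => ?_
    rw [rescaledCorrelator_apply, criticalCorr_eq_zero_of_odd (d := 3) le_rfl hn, mul_zero]
  exact tendsto_nhds_unique h h0

/-- Moving a point of the open upper half-space further up does not bring it closer to a point of the open lower
half-space. [folklore] -/
theorem dist_le_dist_add_single_os (τ : Fin 3) {p q : EuclideanSpace ℝ (Fin 3)} (hp : p τ < 0) (hq : 0 < q τ)
    {t : ℝ} (ht : 0 ≤ t) : dist p q ≤ dist p (q + EuclideanSpace.single τ t) := by
  rw [EuclideanSpace.dist_eq, EuclideanSpace.dist_eq]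
  refine Real.sqrt_le_sqrt (Finset.sum_le_sum fun i _ => ?_)
  rw [Real.dist_eq, Real.dist_eq, sq_abs, sq_abs, PiLp.add_apply, EuclideanSpace.single, PiLp.single_apply]
  split_ifs with h
  · subst h; nlinarith
  · rw [add_zero]

/-- A finite injective configuration has a positive least pair distance. [folklore] -/
theorem exists_pos_le_dist_os {N : ℕ} {w : Fin N → EuclideanSpace ℝ (Fin 3)} (hw : Function.Injective w) :
    ∃ d₀ : ℝ, 0 < d₀ ∧ ∀ i j, i ≠ j → d₀ ≤ dist (w i) (w j) := by
  classical
  by_cases hne : ((Finset.univ : Finset (Fin N × Fin N)).filter fun p => p.1 ≠ p.2).Nonempty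
  · obtain ⟨p₀, hp₀, hmin⟩ := Finset.exists_min_image _ (fun p : Fin N × Fin N => dist (w p.1) (w p.2)) hne
    have hp₀' : p₀.1 ≠ p₀.2 := (Finset.mem_filter.1 hp₀).2
    refine ⟨dist (w p₀.1) (w p₀.2), dist_pos.2 fun h => hp₀' (hw h), fun i j hij => ?_⟩
    exact hmin (i, j) (Finset.mem_filter.2 ⟨Finset.mem_univ _, hij⟩)
  · refine ⟨1, one_pos, fun i j hij => ?_⟩
    exact absurd ⟨(i, j), Finset.mem_filter.2 ⟨Finset.mem_univ _, hij⟩⟩ hne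

/-- **Under the two-point law the exponent is nonnegative**: `⟨σ₀σ_y⟩‖y‖^{2Δ} → c > 0` with `|⟨σ₀σ_y⟩| ≤ 1` forces
`0 ≤ Δ` (along `y = ⌊k+1⌋e₀`, `Δ < 0` would make the product tend to `0`). [folklore] -/
theorem delta_nonneg_of_twoPointLaw_os {Δ c : ℝ} (hc : 0 < c)
    (hG : Tendsto (fun y : Site 3 => criticalTwoPoint 3 y * Real.sqrt (∑ i, ((y i : ℝ)) ^ 2) ^ (2 * Δ))
      cofinite (𝓝 c)) : 0 ≤ Δ := by
  by_contra hΔ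
  push Not at hΔ
  have hu : Tendsto (fun k : ℕ => 1 / ((k : ℝ) + 1)) atTop (𝓝[>] (0 : ℝ)) := by
    refine tendsto_nhdsWithin_iff.2 ⟨tendsto_one_div_add_atTop_nhds_zero_nat, ?_⟩
    exact Filter.Eventually.of_forall fun k => by
      show (0 : ℝ) < 1 / ((k : ℝ) + 1)
      positivity
  have h := tendsto_criticalTwoPoint_pin_mul_rpow hG hu
  -- the same sequence tends to `0`
  have h0 : Tendsto (fun k : ℕ => criticalTwoPoint 3 (Pi.single 0 (⌊1 / (1 / ((k : ℝ) + 1))⌋ : ℤ) : Site 3) *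
      (1 / ((k : ℝ) + 1)) ^ (-(2 * Δ))) atTop (𝓝 0) := by
    have hpow : Tendsto (fun k : ℕ => (1 / ((k : ℝ) + 1)) ^ (-(2 * Δ))) atTop (𝓝 0) := by
      have h1 : Tendsto (fun k : ℕ => ((k : ℝ) + 1) ^ (-(-(2 * Δ)))) atTop (𝓝 0) :=
        (tendsto_rpow_neg_atTop (by linarith : 0 < -(2 * Δ))).comp
          (tendsto_natCast_atTop_atTop.atTop_add tendsto_const_nhds)
      refine h1.congr fun k => ?_
      rw [neg_neg, one_div, Real.inv_rpow (by positivity), Real.rpow_neg (by positivity), inv_inv]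
    refine squeeze_zero_norm (fun k => ?_) hpow
    rw [norm_mul, Real.norm_eq_abs, Real.norm_eq_abs,
      abs_of_nonneg (Real.rpow_nonneg (by positivity) _)]
    refine mul_le_of_le_one_left (Real.rpow_nonneg (by positivity) _) ?_
    rw [← criticalCorr_two]
    exact abs_criticalCorr_le_one le_rfl _ _
  exact hc.ne' (tendsto_nhds_unique h h0)

/-- **NO GROWTH IN THE TIME DIRECTION**: for a normalised cluster point with the pure-power pair function
`S₂ = ‖x−y‖^{-2Δ}`, `Δ ≥ 0`, every OS kernel entry is bounded under time translation of its second argument: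
`|S(θ_τ a, b + t e_τ)| ≤ C` for `t ≥ 0` — odd total order vanishes; at even order `2m`, `0 ≤ S ≤ 𝒢_m[S₂]`
(`clusterPoint_le_pairingSum`, Newman's Gaussian inequality in the limit) and every pair of the configuration stays at
distance `≥ d₀ > 0` (the least pair distance at `t = 0`; cross pairs only separate), so `𝒢_m[S₂] ≤ (2m)! d₀^{-2Δm}`.
[cite: OsterwalderSchrader1973, §4.1 eq. (4.8)] -/
theorem IsClusterPoint.hasPolynomialTimeGrowth_os {Δ : ℝ} (hΔ : 0 ≤ Δ) {S : CorrFamily 3} (hS : IsClusterPoint S)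
    (hN : IsNormalised S) (h2 : ∀ x ∈ NonCoincident 3 2, S 2 x = ‖x 0 - x 1‖ ^ (-(2 * Δ))) (τ : Fin 3) :
    HasPolynomialTimeGrowth τ S := by
  intro a b
  classical
  set w₀ : Fin (a.n + b.n) → EuclideanSpace ℝ (Fin 3) :=
    Fin.append (fun l => axisReflection τ (a.pts l)) b.pts with hw₀
  have hw₀inj : Function.Injective w₀ := osPointKernel_arg_injective a b
  obtain ⟨d₀, hd₀, hd₀le⟩ := exists_pos_le_dist_os hw₀inj
  rcases Nat.even_or_odd (a.n + b.n) with ⟨m, hm⟩ | hodd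
  · -- even total order `2m`
    have h2m : a.n + b.n = 2 * m := by omega
    set B : ℝ := d₀ ^ (-(2 * Δ)) with hB
    have hB0 : 0 ≤ B := Real.rpow_nonneg hd₀.le _
    refine ⟨(2 * m).factorial * B ^ m, 0, fun t ht => ?_⟩
    rw [pow_zero, mul_one, HalfSpaceConfig.timeShift_of_nonneg ht]
    set wt : Fin (a.n + b.n) → EuclideanSpace ℝ (Fin 3) :=
      Fin.append (fun l => axisReflection τ (a.pts l)) (fun l => b.pts l + EuclideanSpace.single τ t) with hwt
    have hwtinj : Function.Injective wt :=
      osPointKernel_arg_injective a (b.translate (EuclideanSpace.single τ t) (by simpa using ht))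
    have hker : osPointKernel S a (b.translate (EuclideanSpace.single τ t) (by simpa using ht)) =
        S (a.n + b.n) wt := rfl
    have hsep : ∀ i j, i ≠ j → d₀ ≤ dist (wt i) (wt j) := by
      intro i j hij
      refine (hd₀le i j hij).trans ?_
      rw [hw₀, hwt]
      refine Fin.addCases (fun i hij => ?_) (fun i hij => ?_) i hij <;>
        refine Fin.addCases (fun j _ => ?_) (fun j _ => ?_) j hij
      · simp only [Fin.append_left]; exact le_rfl
      · simp only [Fin.append_left, Fin.append_right]
        refine dist_le_dist_add_single_os τ ?_ (b.pos j) ht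
        simpa using a.pos i
      · simp only [Fin.append_left, Fin.append_right]
        rw [dist_comm, dist_comm (b.pts i + _)]
        refine dist_le_dist_add_single_os τ ?_ (b.pos i) ht
        simpa using a.pos j
      · simp only [Fin.append_right]
        rw [dist_add_right]
    set wc : Fin (2 * m) → EuclideanSpace ℝ (Fin 3) := fun i => wt (Fin.cast h2m.symm i) with hwc
    have hwcinj : Function.Injective wc := hwtinj.comp (Fin.cast_injective _)
    have hwcmem : wc ∈ NonCoincident 3 (2 * m) := (mem_nonCoincident wc).2 hwcinj
    obtain ⟨hlow, hup⟩ := clusterPoint_le_pairingSum S hS m wc hwcmem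
    have hcast : S (a.n + b.n) wt = S (2 * m) wc := corr_cast_os S h2m wt
    have hdiag : ∀ i : Fin (2 * m), S 2 ![wc i, wc i] = 0 := fun i =>
      hN 2 _ (by rw [mem_nonCoincident]; intro h; exact absurd (@h 0 1 rfl) (by decide))
    have hoff : ∀ i j : Fin (2 * m), i ≠ j → (![wc i, wc j] : Fin 2 → EuclideanSpace ℝ (Fin 3)) ∈ NonCoincident 3 2 := by
      intro i j hij
      rw [mem_nonCoincident]
      intro k l hkl
      fin_cases k <;> fin_cases l
      · rfl
      · exact absurd (hwcinj hkl) hij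
      · exact absurd (hwcinj hkl.symm) hij
      · rfl
    have hpair0 : ∀ i j : Fin (2 * m), 0 ≤ S 2 ![wc i, wc j] := by
      intro i j
      by_cases hij : i = j
      · subst hij; rw [hdiag]
      · rw [h2 _ (hoff i j hij)]
        exact Real.rpow_nonneg (norm_nonneg _) _
    have hpairB : ∀ i j : Fin (2 * m), S 2 ![wc i, wc j] ≤ B := by
      intro i j
      by_cases hij : i = j
      · subst hij; rw [hdiag]; exact hB0
      · rw [h2 _ (hoff i j hij)]
        simp only [Matrix.cons_val_zero, Matrix.cons_val_one]
        refine Real.rpow_le_rpow_of_nonpos hd₀ ?_ (by linarith)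
        rw [← dist_eq_norm]
        exact hsep _ _ fun h => hij (Fin.cast_injective _ h)
    have hps : pairingSum (fun p q => S 2 ![p, q]) m wc ≤ (2 * m).factorial * B ^ m :=
      pairingSum_le_factorial_mul_pow (S := fun i j : Fin (2 * m) => S 2 ![wc i, wc j]) hpair0 hpairB m id
    rw [hker, hcast, abs_of_nonneg hlow]
    exact hup.trans hps
  · -- odd total order: the kernel vanishes
    refine ⟨0, 0, fun t ht => ?_⟩
    rw [HalfSpaceConfig.timeShift_of_nonneg ht]
    have hker : osPointKernel S a (b.translate (EuclideanSpace.single τ t) (by simpa using ht)) =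
        S (a.n + b.n) (Fin.append (fun l => axisReflection τ (a.pts l))
          (fun l => b.pts l + EuclideanSpace.single τ t)) := rfl
    have hmem : (Fin.append (fun l => axisReflection τ (a.pts l)) (fun l => b.pts l + EuclideanSpace.single τ t) :
        Fin (a.n + b.n) → EuclideanSpace ℝ (Fin 3)) ∈ NonCoincident 3 (a.n + b.n) :=
      (mem_nonCoincident _).2
        (osPointKernel_arg_injective a (b.translate (EuclideanSpace.single τ t) (by simpa using ht)))
    rw [hker, clusterPoint_eq_zero_of_odd_os hS hodd hmem]
    simp

/-- **OSTERWALDER–SCHRADER RECONSTRUCTION FOR CLUSTER POINTS OF THE PINNED CRITICAL ZOOM.** A REGULAR cluster point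
(normalised, continuous off the diagonals, translation invariant) with the pure-power pair function `‖x−y‖^{-2Δ}`,
`Δ ≥ 0` — under item 0634's two-point law every cluster point is such (`stub_pinnedTwoPoint`,
`delta_nonneg_of_twoPointLaw_os`, `pinnedZoom_compactness`) — satisfies all premises of the tree's pointwise OS
reconstruction along EVERY coordinate axis `τ`: a Hilbert space, a vacuum, a positive contraction semigroup `e^{-tH_τ}`
and unitary spatial translations act on the span of its half-space point insertions (`PointwiseOSReconstruction`, by dot
notation). In particular this holds for the interacting cluster points of the residue 5′.
[cite: GlimmJaffe1987, §6.1 Thm. 6.1.3] [cite: FILS1978, §2] -/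
theorem IsClusterPoint.pointwiseOSReconstruction_os {Δ : ℝ} (hΔ : 0 ≤ Δ) {S : CorrFamily 3}
    (hS : IsClusterPoint S) (hreg : IsRegular S)
    (h2 : ∀ x ∈ NonCoincident 3 2, S 2 x = ‖x 0 - x 1‖ ^ (-(2 * Δ))) (τ : Fin 3) :
    PointwiseOSReconstruction τ S where
  reflectionPositive := hS.isReflectionPositiveAlong_os hreg.2.1 τ
  reflectionInvariant := hS.isReflectionInvariantAlong_os hreg.1 hreg.2.1 τ
  symmetric := hS.isPermutationSymmetric_os hreg.1
  translationInvariant := hreg.2.2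
  polynomialGrowth := hS.hasPolynomialTimeGrowth_os hΔ hreg.1 h2 τ

/-- **Registered anchor of this file** (`clusterPoint_reflectionPositive`): OS positivity of cluster points along every
axis, explicit-binder form of `IsClusterPoint.isReflectionPositiveAlong_os`. [cite: FILS1978, §2] -/
theorem clusterPoint_reflectionPositive :
    ∀ (S : CorrFamily 3), IsClusterPoint S → (∀ n, ContinuousOn (S n) (NonCoincident 3 n)) →
      ∀ τ : Fin 3, Literature.MathematicalPhysics.QuantumFieldTheory.IsReflectionPositiveAlong τ S :=
  fun _ hS hcont τ => hS.isReflectionPositiveAlong_os hcont τ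

end Summit.CriticalPhenomena.Ising3DConformalLimit.MoebiusLimitExistsOnlyInteraction

end
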